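/-
Copyright (c) 2026. All rights reserved.
Released under Apache 2.0 license as described in the file LICENSE.
-/
import Summits.HodgeConjecture.HodgeConjecture.Theorems.K2E1SphericalEisensteinSolvesXSystemU2     -- ★ p859074 (this seat) part 1: (S2), (S3), ℓ8 compat, ℓ10 hX
import Summits.HodgeConjecture.HodgeConjecture.Theorems.K2E1BLHeckeOperatorHXU2Op                   -- ★ p858992 (K2E1-p09 g6) P3-C: `exists_shiftOperatorX` letter shape, `convX_congr_ae`, `ae_withDensity_weightX_iff`
import Summits.HodgeConjecture.HodgeConjecture.Theorems.K2E1SphericalEisensteinHeckeEigenU2           -- ★ p858984 (this seat) ℓ9: `integral_mul_eisensteinSeriesU_eq_cm_two`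
import HarnessLib

/-!
# EIS-R7-BL-SPH-2 «E_z SOLVES THE 𝔛-SYSTEM» — part 2: (S1) `T_X [Ẽ_z] = ĥ(z)•[Ẽ_z]` and the packaged head

Sequel of ★ part 1 `K2E1SphericalEisensteinSolvesXSystemU2` (same deal, K2E1-plan (g5) 2026-09-04T09:30:05Z; split only for the 400-line rule).
(S1): for ANY bounded operator `T` on `𝓗_k(𝔛)` that is a.e. the right convolution `u ↦ ∫ h(y)·u(y⁻¹•ξ) dνG(y)` (the conclusion shape of ★ P3-C
`K2E1BLHeckeOperatorHXU2Op.exists_shiftOperatorX`), with `h` continuous, compactly supported, left-`K_U`-invariant, and `1 < Re z`: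
`T [Ẽ_z] = ĥ(z)•[Ẽ_z]`, `ĥ(z) = ∫ h(x)H(x)^z dνG` — ★ ℓ9 (the series-level Hecke identity) on representatives, `Ẽ_z(y⁻¹•[g₀]) = E_z(g₀⁻¹y)`, moved
through the a.e. class by ★ P3-C `convX_congr_ae`.  HEAD `sphericalEisenstein_solves_xSystem_cm_two`: `ψ := toHX k μ E_z` and some `b` solve all three
equations `(∀ i, T_i ψ = ĥ_i(z)•ψ) ∧ cnst_N(ι ψ) = φ₀•[H^z] + b•[H^{1−z}] ∧ Q ψ = 0` of ★ G-c `exists_xSystem` (part 1 §2, §4 for the last two).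

Count-neutral helper (supports h413 = stmt-HodgeConjecture-24833); HC_CM stays proved only modulo its printed citations.

References: [cite: BernsteinLapid2019, §4 (Claims 1–5, pp. 9–10), §7] (arXiv:1911.02342); [cite: MoeglinWaldspurger1995, II.1.7, IV.1.8].
-/

open MeasureTheory Measure NumberField IsDedekindDomain Set Filter MulAction
open scoped ENNReal NNReal ComplexConjugate
open Literature.MeasureTheory.Group Literature.NumberTheory Literature.NumberTheory.Automorphic Literature.NumberTheory.Automorphic.UnitaryGroup AdelicGroupData
open Summit.HodgeConjecture.HodgeConjecture.Cruxes.H413.K2E1BorelEisensteinU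
open Summit.HodgeConjecture.HodgeConjecture.Cruxes.H413.K2E1BLBorelSpacesU2Defs
open Summit.HodgeConjecture.HodgeConjecture.Cruxes.H413.K2E1BLBorelOperatorsU2Defs

namespace Summit.HodgeConjecture.HodgeConjecture.Cruxes.H413.K2E1SphericalEisensteinSolvesXSystemU2

/-! ## §5 (S1) `T_X [Ẽ_z] = ĥ(z)•[Ẽ_z]` on P3-C's operator letter, and the packaged head -/

open Summit.HodgeConjecture.HodgeConjecture.Cruxes.H413.K2E1BLHeckeOperatorHXU2 (convX_congr_ae)
open Summit.HodgeConjecture.HodgeConjecture.Cruxes.H413.K2E1BLHeckeOperatorHXU2Op (ae_withDensity_weightX_iff)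
open Summit.HodgeConjecture.HodgeConjecture.Cruxes.H413.K2E1SphericalEisensteinHeckeEigenU2 (integral_mul_eisensteinSeriesU_eq_cm_two)

section HeckeEigen

variable (L : Type) [Field L] [NumberField L] [IsCMField L]
variable [MeasurableSpace (quasiSplit (↥(maximalRealSubfield L)) L (IsCMField.complexConj L) 2).Adelic] [BorelSpace (quasiSplit (↥(maximalRealSubfield L)) L (IsCMField.complexConj L) 2).Adelic]

omit [MeasurableSpace (quasiSplit (↥(maximalRealSubfield L)) L (IsCMField.complexConj L) 2).Adelic] [BorelSpace (quasiSplit (↥(maximalRealSubfield L)) L (IsCMField.complexConj L) 2).Adelic] in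
/-- `φ̃(y⁻¹ • [g₀]) = φ(g₀⁻¹·y)` for left-`G(F)`-invariant `φ` (`y⁻¹ • [g₀] = [y⁻¹g₀]` by definition of the action, ★ `quotFun_toAutomorphicQuotient`): the right translation by `y`
on `G(𝔸)` read on `𝔛` through the dictionary `φ̃[g] = φ(g⁻¹)`. [cite: BernsteinLapid2019, §4 p. 10] -/
theorem quotFun_inv_smul_toAutomorphicQuotient {φ : (quasiSplit (↥(maximalRealSubfield L)) L (IsCMField.complexConj L) 2).Adelic → ℂ}
    (hφ : ∀ γ ∈ (quasiSplit (↥(maximalRealSubfield L)) L (IsCMField.complexConj L) 2).quotientSubgroup, ∀ g, φ (γ * g) = φ g) (y g₀ : (quasiSplit (↥(maximalRealSubfield L)) L (IsCMField.complexConj L) 2).Adelic) :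
    (quasiSplit (↥(maximalRealSubfield L)) L (IsCMField.complexConj L) 2).quotFun φ (y⁻¹ • (quasiSplit (↥(maximalRealSubfield L)) L (IsCMField.complexConj L) 2).toAutomorphicQuotient g₀) = φ (g₀⁻¹ * y) := by
  change (quasiSplit (↥(maximalRealSubfield L)) L (IsCMField.complexConj L) 2).quotFun φ ((quasiSplit (↥(maximalRealSubfield L)) L (IsCMField.complexConj L) 2).toAutomorphicQuotient (y⁻¹ * g₀)) = _
  rw [AdelicGroupData.quotFun_toAutomorphicQuotient hφ, mul_inv_rev, inv_inv]

/-- **(S1) `T_X [Ẽ_z] = ĥ(z)•[Ẽ_z]` ON P3-C's LETTER.**  On `U(1,1)_{L/L⁺}`, `1 < Re z`: for ANY bounded operator `T` on `𝓗_k(𝔛)` which is a.e. the right convolution by `h`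
(★ P3-C `exists_shiftOperatorX`: `⇑(T u) =ᵐ ∫ h(y)·u(y⁻¹•ξ) dνG(y)`), with `h` continuous, compactly supported and left-`K_U`-invariant,
`T [Ẽ_z] = ĥ(z)•[Ẽ_z]`, `ĥ(z) = ∫ h(x)H(x)^z dνG` — ★ ℓ9 `integral_mul_eisensteinSeriesU_eq_cm_two` on representatives (`Ẽ_z(y⁻¹•[g₀]) = E_z(g₀⁻¹y)`), transported through the
a.e. class by ★ P3-C `convX_congr_ae` (invariance of `μ`). [cite: BernsteinLapid2019, §4 Claim 1(a) p. 9, p. 10] [cite: MoeglinWaldspurger1995, II.1.7] -/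
theorem shiftOperatorX_toHX_eisensteinSeriesU_eq_smul_cm_two
    (μ : Measure (quasiSplit (↥(maximalRealSubfield L)) L (IsCMField.complexConj L) 2).automorphicQuotient) [(quasiSplit (↥(maximalRealSubfield L)) L (IsCMField.complexConj L) 2).IsAutomorphicMeasure μ] (νG : Measure (quasiSplit (↥(maximalRealSubfield L)) L (IsCMField.complexConj L) 2).Adelic) [νG.IsHaarMeasure] [SFinite νG]
    {h : (quasiSplit (↥(maximalRealSubfield L)) L (IsCMField.complexConj L) 2).Adelic → ℂ} (hK : ∀ k₀ : (quasiSplit (↥(maximalRealSubfield L)) L (IsCMField.complexConj L) 2).Adelic, adelicVal (↥(maximalRealSubfield L)) L (IsCMField.complexConj L) 2 ((StdForm.antidiagonal 2).over L) k₀ ∈ standardMaximalCompactGL 2 L → ∀ x, h (k₀ * x) = h x) (hhc : Continuous h) (hhs : HasCompactSupport h)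
    (φ₀ : ℂ) {z : ℂ} (hz : 1 < z.re) {k : ℕ} (hE : MemLp ((quasiSplit (↥(maximalRealSubfield L)) L (IsCMField.complexConj L) 2).quotFun (eisensteinSeriesU (flatSectionU (fun _ : (quasiSplit (↥(maximalRealSubfield L)) L (IsCMField.complexConj L) 2).Adelic => φ₀) z))) 2 (μ.withDensity fun x => (((supHeight (↥(maximalRealSubfield L)) L (IsCMField.complexConj L) 2 x)⁻¹ ^ (2 * k) : ℝ≥0) : ℝ≥0∞)))
    (T : HX (↥(maximalRealSubfield L)) L (IsCMField.complexConj L) 2 k μ →L[ℂ] HX (↥(maximalRealSubfield L)) L (IsCMField.complexConj L) 2 k μ)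
    (hT : ∀ u : HX (↥(maximalRealSubfield L)) L (IsCMField.complexConj L) 2 k μ, ((T u : HX (↥(maximalRealSubfield L)) L (IsCMField.complexConj L) 2 k μ) : (quasiSplit (↥(maximalRealSubfield L)) L (IsCMField.complexConj L) 2).automorphicQuotient → ℂ) =ᵐ[μ.withDensity fun x => (((supHeight (↥(maximalRealSubfield L)) L (IsCMField.complexConj L) 2 x)⁻¹ ^ (2 * k) : ℝ≥0) : ℝ≥0∞)] fun ξ => ∫ y, h y * (u : (quasiSplit (↥(maximalRealSubfield L)) L (IsCMField.complexConj L) 2).automorphicQuotient → ℂ) (y⁻¹ • ξ) ∂νG) :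
    T (toHX (↥(maximalRealSubfield L)) L (IsCMField.complexConj L) 2 k μ (eisensteinSeriesU (flatSectionU (fun _ : (quasiSplit (↥(maximalRealSubfield L)) L (IsCMField.complexConj L) 2).Adelic => φ₀) z)) hE) = (∫ x, h x * (((borelHeight x : ℝ)) : ℂ) ^ z ∂νG) • toHX (↥(maximalRealSubfield L)) L (IsCMField.complexConj L) 2 k μ (eisensteinSeriesU (flatSectionU (fun _ : (quasiSplit (↥(maximalRealSubfield L)) L (IsCMField.complexConj L) 2).Adelic => φ₀) z)) hE := by
  have hφ := eisensteinSeriesU_flatSectionU_quotientSubgroup_mul L φ₀ z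
  have hψ : ((toHX (↥(maximalRealSubfield L)) L (IsCMField.complexConj L) 2 k μ (eisensteinSeriesU (flatSectionU (fun _ : (quasiSplit (↥(maximalRealSubfield L)) L (IsCMField.complexConj L) 2).Adelic => φ₀) z)) hE : HX (↥(maximalRealSubfield L)) L (IsCMField.complexConj L) 2 k μ) : (quasiSplit (↥(maximalRealSubfield L)) L (IsCMField.complexConj L) 2).automorphicQuotient → ℂ) =ᵐ[μ.withDensity fun x => (((supHeight (↥(maximalRealSubfield L)) L (IsCMField.complexConj L) 2 x)⁻¹ ^ (2 * k) : ℝ≥0) : ℝ≥0∞)] (quasiSplit (↥(maximalRealSubfield L)) L (IsCMField.complexConj L) 2).quotFun (eisensteinSeriesU (flatSectionU (fun _ : (quasiSplit (↥(maximalRealSubfield L)) L (IsCMField.complexConj L) 2).Adelic => φ₀) z)) := by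
    unfold toHX; exact hE.coeFn_toLp
  -- Hecke on representatives: `∫ h(y)·Ẽ_z(y⁻¹•ξ) dνG = ĥ(z)·Ẽ_z(ξ)` for EVERY `ξ`
  have hev : ∀ ξ : (quasiSplit (↥(maximalRealSubfield L)) L (IsCMField.complexConj L) 2).automorphicQuotient, ∫ y, h y * (quasiSplit (↥(maximalRealSubfield L)) L (IsCMField.complexConj L) 2).quotFun (eisensteinSeriesU (flatSectionU (fun _ : (quasiSplit (↥(maximalRealSubfield L)) L (IsCMField.complexConj L) 2).Adelic => φ₀) z)) (y⁻¹ • ξ) ∂νG = (∫ x, h x * (((borelHeight x : ℝ)) : ℂ) ^ z ∂νG) * (quasiSplit (↥(maximalRealSubfield L)) L (IsCMField.complexConj L) 2).quotFun (eisensteinSeriesU (flatSectionU (fun _ : (quasiSplit (↥(maximalRealSubfield L)) L (IsCMField.complexConj L) 2).Adelic => φ₀) z)) ξ := by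
    intro ξ
    obtain ⟨g₀, rfl⟩ := QuotientGroup.mk_surjective ξ
    change ∫ y, h y * (quasiSplit (↥(maximalRealSubfield L)) L (IsCMField.complexConj L) 2).quotFun (eisensteinSeriesU (flatSectionU (fun _ : (quasiSplit (↥(maximalRealSubfield L)) L (IsCMField.complexConj L) 2).Adelic => φ₀) z)) (y⁻¹ • (quasiSplit (↥(maximalRealSubfield L)) L (IsCMField.complexConj L) 2).toAutomorphicQuotient g₀) ∂νG = (∫ x, h x * (((borelHeight x : ℝ)) : ℂ) ^ z ∂νG) * (quasiSplit (↥(maximalRealSubfield L)) L (IsCMField.complexConj L) 2).quotFun (eisensteinSeriesU (flatSectionU (fun _ : (quasiSplit (↥(maximalRealSubfield L)) L (IsCMField.complexConj L) 2).Adelic => φ₀) z)) ((quasiSplit (↥(maximalRealSubfield L)) L (IsCMField.complexConj L) 2).toAutomorphicQuotient g₀)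
    simp only [quotFun_inv_smul_toAutomorphicQuotient L hφ, AdelicGroupData.quotFun_toAutomorphicQuotient hφ]
    exact integral_mul_eisensteinSeriesU_eq_cm_two L νG hK hhc hhs φ₀ hz g₀⁻¹
  have h2 := convX_congr_ae νG μ h ((ae_withDensity_weightX_iff μ k).1 hψ)
  refine Lp.ext ((hT _).trans (EventuallyEq.trans ?_ (Lp.coeFn_smul _ _).symm))
  refine (ae_withDensity_weightX_iff μ k).2 ?_
  filter_upwards [h2, (ae_withDensity_weightX_iff μ k).1 hψ] with ξ hξ hψξ
  rw [hξ, hev ξ, Pi.smul_apply, smul_eq_mul, hψξ]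

/-- **HEAD — `E_z` SOLVES THE 𝔛-SYSTEM** of ★ G-c `K2E1BLXSystemPackage.exists_xSystem` on `U(1,1)_{L/L⁺}`: for `1 < Re z ≤ k`, the element `ψ := toHX k μ E(φ₀H^z) ∈ 𝓗_k(𝔛)` and
SOME `b : ℂ` satisfy ALL THREE equations — (S1) `T_i ψ = ĥ_i(z)•ψ` for every operator `T_i` a.e. equal to the right convolution by a continuous compactly supported left-`K_U`-invariant
`h_i` (P3-C's letter), (S2) `cnst_N(ι ψ) = φ₀•[H^z] + b•[H^{1−z}]` in `𝓗_k(Z_a)`, (S3) `Q ψ = 0` for `Q` the projection onto the closed span of any set of cusp-weight classes `[w₁^{2k}φ̃]`,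
`φ ∈ 𝒞_k` Borel. Letters: structural (`μ` automorphic, `νG` Haar inversion-invariant s-finite, `ν`, `𝓕` with `h𝓕N h𝓕c`, `δ` trace-zero ≠ 0, `hb : IotaBound`, `wtm_{k,a}` finite),
`hdis'` (★ p858957 under its letters), `hE` (★ (b1)), `hα₁ hα₂` (ℓ7). [cite: BernsteinLapid2019, §4 (Claims 1–5, pp. 9–10), §7] [cite: MoeglinWaldspurger1995, II.1.7, IV.1.8] -/
theorem sphericalEisenstein_solves_xSystem_cm_two {δ : L} (hcδ : IsCMField.complexConj L δ = -δ) (hδ : δ ≠ 0)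
    (μ : Measure (quasiSplit (↥(maximalRealSubfield L)) L (IsCMField.complexConj L) 2).automorphicQuotient) [(quasiSplit (↥(maximalRealSubfield L)) L (IsCMField.complexConj L) 2).IsAutomorphicMeasure μ] (νG : Measure (quasiSplit (↥(maximalRealSubfield L)) L (IsCMField.complexConj L) 2).Adelic) [νG.IsHaarMeasure] [νG.IsInvInvariant] [SFinite νG]
    (ν : Measure ↥(adelicUnipotent (↥(maximalRealSubfield L)) L (IsCMField.complexConj L) 2)) [ν.IsHaarMeasure] [ν.IsMulRightInvariant] [ν.IsInvInvariant]
    {𝓕 : Set ↥(adelicUnipotent (↥(maximalRealSubfield L)) L (IsCMField.complexConj L) 2)}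
    (h𝓕N : IsFundamentalDomain ↥(rationalUnipotent (↥(maximalRealSubfield L)) L (IsCMField.complexConj L) 2) 𝓕 ν) (h𝓕c : IsCompact (closure 𝓕))
    {k : ℕ} {a : ℝ≥0} {μZ : Measure (borelQuotient (↥(maximalRealSubfield L)) L (IsCMField.complexConj L) 2)} [IsFiniteMeasure (weightedTruncMeasure (↥(maximalRealSubfield L)) L (IsCMField.complexConj L) 2 k a μZ)] (hb : IotaBound (↥(maximalRealSubfield L)) L (IsCMField.complexConj L) 2 k a μ μZ)
    (hdis' : ∀ Φ : (quasiSplit (↥(maximalRealSubfield L)) L (IsCMField.complexConj L) 2).Adelic → ℂ, Measurable Φ → (∀ b ∈ ratBorelSubgroup (↥(maximalRealSubfield L)) L (IsCMField.complexConj L) 2, ∀ g, Φ (b * g) = Φ g) →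
      Integrable (zFun (↥(maximalRealSubfield L)) L (IsCMField.complexConj L) 2 Φ) (weightedTruncMeasure (↥(maximalRealSubfield L)) L (IsCMField.complexConj L) 2 k a μZ) →
      Integrable (zFun (↥(maximalRealSubfield L)) L (IsCMField.complexConj L) 2 (borelConstantTerm ν 𝓕 Φ)) (weightedTruncMeasure (↥(maximalRealSubfield L)) L (IsCMField.complexConj L) 2 k a μZ) →
        ∫ x, zFun (↥(maximalRealSubfield L)) L (IsCMField.complexConj L) 2 (borelConstantTerm ν 𝓕 Φ) x ∂(weightedTruncMeasure (↥(maximalRealSubfield L)) L (IsCMField.complexConj L) 2 k a μZ) = ∫ x, zFun (↥(maximalRealSubfield L)) L (IsCMField.complexConj L) 2 Φ x ∂(weightedTruncMeasure (↥(maximalRealSubfield L)) L (IsCMField.complexConj L) 2 k a μZ))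
    {I : Type*} {h : I → (quasiSplit (↥(maximalRealSubfield L)) L (IsCMField.complexConj L) 2).Adelic → ℂ} (hK : ∀ i, ∀ k₀ : (quasiSplit (↥(maximalRealSubfield L)) L (IsCMField.complexConj L) 2).Adelic, adelicVal (↥(maximalRealSubfield L)) L (IsCMField.complexConj L) 2 ((StdForm.antidiagonal 2).over L) k₀ ∈ standardMaximalCompactGL 2 L → ∀ x, h i (k₀ * x) = h i x) (hhc : ∀ i, Continuous (h i)) (hhs : ∀ i, HasCompactSupport (h i))
    (T : I → HX (↥(maximalRealSubfield L)) L (IsCMField.complexConj L) 2 k μ →L[ℂ] HX (↥(maximalRealSubfield L)) L (IsCMField.complexConj L) 2 k μ)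
    (hT : ∀ i, ∀ u : HX (↥(maximalRealSubfield L)) L (IsCMField.complexConj L) 2 k μ, ((T i u : HX (↥(maximalRealSubfield L)) L (IsCMField.complexConj L) 2 k μ) : (quasiSplit (↥(maximalRealSubfield L)) L (IsCMField.complexConj L) 2).automorphicQuotient → ℂ) =ᵐ[μ.withDensity fun x => (((supHeight (↥(maximalRealSubfield L)) L (IsCMField.complexConj L) 2 x)⁻¹ ^ (2 * k) : ℝ≥0) : ℝ≥0∞)] fun ξ => ∫ y, h i y * (u : (quasiSplit (↥(maximalRealSubfield L)) L (IsCMField.complexConj L) 2).automorphicQuotient → ℂ) (y⁻¹ • ξ) ∂νG)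
    {𝒮 : Set (HX (↥(maximalRealSubfield L)) L (IsCMField.complexConj L) 2 k μ)}
    (h𝒮 : ∀ s ∈ 𝒮, ∃ φ ∈ cuspTestClass (↥(maximalRealSubfield L)) L (IsCMField.complexConj L) 2 k ν 𝓕 μ, Measurable φ ∧
      (s : (quasiSplit (↥(maximalRealSubfield L)) L (IsCMField.complexConj L) 2).automorphicQuotient → ℂ) =ᵐ[μ.withDensity fun x => (((supHeight (↥(maximalRealSubfield L)) L (IsCMField.complexConj L) 2 x)⁻¹ ^ (2 * k) : ℝ≥0) : ℝ≥0∞)] fun x => ((supHeight (↥(maximalRealSubfield L)) L (IsCMField.complexConj L) 2 x : ℝ) ^ (2 * k) : ℂ) * (quasiSplit (↥(maximalRealSubfield L)) L (IsCMField.complexConj L) 2).quotFun φ x)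
    (φ₀ : ℂ) {z : ℂ} (hz : 1 < z.re) (hzk : z.re ≤ k) (hE : MemLp ((quasiSplit (↥(maximalRealSubfield L)) L (IsCMField.complexConj L) 2).quotFun (eisensteinSeriesU (flatSectionU (fun _ : (quasiSplit (↥(maximalRealSubfield L)) L (IsCMField.complexConj L) 2).Adelic => φ₀) z))) 2 (μ.withDensity fun x => (((supHeight (↥(maximalRealSubfield L)) L (IsCMField.complexConj L) 2 x)⁻¹ ^ (2 * k) : ℝ≥0) : ℝ≥0∞)))
    (hα₁ : MemLp (zFun (↥(maximalRealSubfield L)) L (IsCMField.complexConj L) 2 (fun g : (quasiSplit (↥(maximalRealSubfield L)) L (IsCMField.complexConj L) 2).Adelic => (((borelHeight g : ℝ)) : ℂ) ^ z)) 2 (weightedTruncMeasure (↥(maximalRealSubfield L)) L (IsCMField.complexConj L) 2 k a μZ))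
    (hα₂ : MemLp (zFun (↥(maximalRealSubfield L)) L (IsCMField.complexConj L) 2 (fun g : (quasiSplit (↥(maximalRealSubfield L)) L (IsCMField.complexConj L) 2).Adelic => (((borelHeight g : ℝ)) : ℂ) ^ (1 - z))) 2 (weightedTruncMeasure (↥(maximalRealSubfield L)) L (IsCMField.complexConj L) 2 k a μZ)) :
    ∃ b : ℂ,
      (∀ i, T i (toHX (↥(maximalRealSubfield L)) L (IsCMField.complexConj L) 2 k μ (eisensteinSeriesU (flatSectionU (fun _ : (quasiSplit (↥(maximalRealSubfield L)) L (IsCMField.complexConj L) 2).Adelic => φ₀) z)) hE) = (∫ x, h i x * (((borelHeight x : ℝ)) : ℂ) ^ z ∂νG) • toHX (↥(maximalRealSubfield L)) L (IsCMField.complexConj L) 2 k μ (eisensteinSeriesU (flatSectionU (fun _ : (quasiSplit (↥(maximalRealSubfield L)) L (IsCMField.complexConj L) 2).Adelic => φ₀) z)) hE) ∧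
      cnstN (↥(maximalRealSubfield L)) L (IsCMField.complexConj L) 2 k a μZ (iota hb (toHX (↥(maximalRealSubfield L)) L (IsCMField.complexConj L) 2 k μ (eisensteinSeriesU (flatSectionU (fun _ : (quasiSplit (↥(maximalRealSubfield L)) L (IsCMField.complexConj L) 2).Adelic => φ₀) z)) hE)) =
        φ₀ • toHN (↥(maximalRealSubfield L)) L (IsCMField.complexConj L) 2 k a μZ (fun g : (quasiSplit (↥(maximalRealSubfield L)) L (IsCMField.complexConj L) 2).Adelic => (((borelHeight g : ℝ)) : ℂ) ^ z) hα₁ + b • toHN (↥(maximalRealSubfield L)) L (IsCMField.complexConj L) 2 k a μZ (fun g : (quasiSplit (↥(maximalRealSubfield L)) L (IsCMField.complexConj L) 2).Adelic => (((borelHeight g : ℝ)) : ℂ) ^ (1 - z)) hα₂ ∧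
      (Submodule.span ℂ 𝒮).topologicalClosure.starProjection (toHX (↥(maximalRealSubfield L)) L (IsCMField.complexConj L) 2 k μ (eisensteinSeriesU (flatSectionU (fun _ : (quasiSplit (↥(maximalRealSubfield L)) L (IsCMField.complexConj L) 2).Adelic => φ₀) z)) hE) = 0 := by
  obtain ⟨b, hb2⟩ := exists_cnstN_iota_toHX_eisensteinSeriesU_eq_cm_two L ν h𝓕N h𝓕c hb hdis' φ₀ hz hE hα₁ hα₂
  exact ⟨b, fun i => shiftOperatorX_toHX_eisensteinSeriesU_eq_smul_cm_two L μ νG (hK i) (hhc i) (hhs i) φ₀ hz hE (T i) (hT i), hb2,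
    starProjection_toHX_eisensteinSeriesU_eq_zero_cm_two L hcδ hδ μ νG ν h𝓕N h𝓕c φ₀ hz hzk hE h𝒮⟩

end HeckeEigen

end Summit.HodgeConjecture.HodgeConjecture.Cruxes.H413.K2E1SphericalEisensteinSolvesXSystemU2
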